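/-
HONEST FRAMING: systematic search; no irrationality claim unless certified.
-/
import Summits.KontsevichZagierPeriods.Zeta5Search.WedgeDictionaryContiguityModule
import HarnessLib

/-!
# The uniform creative-telescoping certificate of the cellular PENCIL(c,7) relation

D2 lane, gen-1 g15 (planner-pub-zeta5-gen-1-g15-0), 2026-08-21.  Companion of
`WedgeDictionaryThreeTerm.lean` (filing request gen-1 g15 #1: the statements `DictPencil`, `CellPencil`
and the 2-of-3 step `at_pencilFan`) and of the memo `pub-zeta5-gen-1/D2-CONNECTION-g15.md` §10.

## What is certified here

Write the generalized cellular integral of Brown–Zudilin [BZ22, (30)] in the Barnes form used by the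
D2 lane since gen-1 g13 (`code/gen1/g13/ctK.py`): `I(a) = κ(p;q) · L[R_{p;q}]`, where `(p;q) = (p₀..p₆; q₁..q₅)`
is the chart (16)–(17) of BZ22 (`p = (a₅+a₆−a₈, a₂+a₃+a₆−a₄−a₈, a₆, a₂+a₃+a₆−a₈, a₇, a₃+a₆−a₈, a₁+a₂+a₆−a₄−a₈)`,
`q = (a₄, a₅, a₁+a₅−a₃, a₁, a₂)`),
`R_{p;q}(s,t) = (s+1)_{p₀} (t+1)_{p₆} (s+t+1−B)_{D₀} / [(s+p₁+1)_{q₁+1} (s+p₂+1)_{q₂+1} (t+p₄+1)_{q₄+1} (t+p₅+1)_{q₅+1}]`,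
`B = q₃−p₀−p₆−1`, `D₀ = p₃+q₃−p₀−p₆`, `κ = (−1)^{B+1} q₁!q₂!q₄!q₅!/(p₀!p₆!D₀!)`, and `L` the double Barnes
sum/integral against `k(s)k(t)k(s+t)`, `k(x) = π / sin πx`.

The PENCIL(c,7) cluster consists of the three parameter points `a`, `a' = a+e₂+e₄` (the dual move `DS`:
`p₃,q₁,q₅ ↦ +1`) and `a'' = a'+e₇` (`p₄ ↦ +1`); on the wedge-dictionary side the three values of
`ω = (Q, P̂, P)` satisfy `c₁ ω(a) + c₂ ω(a') + c₃ ω(a'') = 0` with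
`c₁ = −(b₂+1)(b₃+1) = −(a₂+1)(a₄+1)`, `c₂ = (b₇+1)(b₀+2−b₇)`, `c₃ = (b'₀+1−b'₇−b'₁)(b'₀+1−b'₇−b'₂)`
(`b = bOfA a`; decls `pencilBase`, `pencilApex`, `fanCoeff` of the ThreeTerm file).  The cellular side of the
2-of-3 step needs the SAME relation for the integrals, `c₁ I(a) + c₂ I(a') + c₃ I(a'') = 0` (`CellPencil a 7`).

THEOREM (found 2026-08-21 from five minimal instance certificates, then verified symbolically; this file
is its kernel-checked algebraic core).  With `K = −c₁ κ(a) / (D₀+1)` the ONE-TERM certificate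
`C(s,t) = K · t · (s+t−B) · R_{p;q}(s,t) / (s+p₁+q₁+2)` satisfies, identically in `s,t` and in all eight
parameters,
`c₁κ(a) R_a + c₂κ(a') R_{a'} + c₃κ(a'') R_{a''} = C(s,t+1) − C(s,t)`       (no `Δ_s` part at all).
Dividing by `κ(a) R_a(s,t)` turns every term into a product of linear forms; multiplying through by the
common denominator `(D₀+1)(s+p₁+q₁+2)(t+p₄+q₄+2)(t+p₅+q₅+2)` and cancelling the common factor
`(t+1)(s+t+1−B)` leaves the polynomial identity `pencil7_certificate_identity` below, in the coordinates
`a₁..a₈` (where `D₀+1 = a₄−a₆+a₈+1 = b₆+1`, `s+p₁+q₁+2 = a₂+a₃+a₆−a₈+s+2`, `t+p₄+q₄+2 = a₁+a₇+t+2`,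
`t+p₅+q₅+2 = a₂+a₃+a₆−a₈+t+2`, `t+p₄+1 = a₇+t+1`, `t+p₅+1 = a₃+a₆−a₈+t+1`, `t+p₆+1 = a₁+a₂−a₄+a₆−a₈+t+1`,
`s+t+1−B+D₀ = a₂+a₃+a₆−a₈+s+t+2`, `s+t−B = a₂+a₃−a₄+2a₆−2a₈+s+t+1`, `(q₁+1)(q₅+1) = (a₄+1)(a₂+1) = κ(a')(D₀+1)/κ(a)`).
The three summands on the left are the three cluster points (`T1 ↔ a`, `T2 ↔ a'`, `T3 ↔ a''`), the two on
the right are `C(s,t+1)` and `−C(s,t)`.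

(The divided form — an identity of rational functions under the six obvious non-vanishing conditions — is
NOT restated as a theorem here: `field_simp` on it exceeds the default heartbeat budget; it follows from the
polynomial identity by multiplying out, see `code/gen1/g15/pencil7_uniform.py` for the symbolic check.)

What this does NOT yet give: `CellPencil a 7` itself — that needs the analytic telescoping step (summing /
shifting the `t`-contour with vanishing boundary contributions for the one-term certificate, as in BZ22 §4 and
the gen-1 g13 framework `D2-CONTIGUITY-g13.md`), which is not formalised.  Evidence and derivation:
`code/gen1/g15/{relsolve.py, pencil7_uniform.py, pencil7_uniform.log}`.

References: [BZ22] F. Brown, W. Zudilin, arXiv:2210.03391, (16)–(17), (30), Sect. 4.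
-/

namespace Summit.KontsevichZagierPeriods.Zeta5Search.WedgeDictionary

/-- HONEST FRAMING: systematic search; no irrationality claim unless certified.
The uniform PENCIL(c,7) creative-telescoping identity (see the module docstring for the dictionary
`a ↦ (p;q)` and the meaning of each linear factor): left side = the three cluster terms
`c₁ + c₂ (κ'/κ)(R_{a'}/R_a) + c₃ (κ''/κ)(R_{a''}/R_a)` times the common denominator, right side =
`[C(s,t+1) − C(s,t)] / (κ R_a)` times the same denominator, for the one-term certificate
`C = K t (s+t−B) R_a/(s+p₁+q₁+2)`, `K = (a₂+1)(a₄+1) κ(a)/(D₀+1)`.  Purely polynomial; holds over any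
commutative ring, stated over `ℚ`.  (The parameter `a₅ = q₂` does not occur: the factor
`(s+p₂+1)_{q₂+1}` is common to the three summands and cancels.) -/
theorem pencil7_certificate_identity (a₁ a₂ a₃ a₄ a₆ a₇ a₈ s t : ℚ) :
    ( (-(a₂ + 1) * (a₄ + 1)) * (a₄ - a₆ + a₈ + 1) * (a₂ + a₃ + a₆ - a₈ + s + 2)
          * (a₁ + a₇ + t + 2) * (a₂ + a₃ + a₆ - a₈ + t + 2)
      + (a₄ - a₆ + a₇ + a₈ + 2) * (a₂ + a₃ + a₆ - a₇ - a₈ + 1) * ((a₂ + 1) * (a₄ + 1))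
          * (a₂ + a₃ + a₆ - a₈ + s + t + 2) * (a₁ + a₇ + t + 2)
      + (-(a₁ - a₃ - a₆ + a₇ + a₈ + 1) * (a₂ - a₄ + a₆ - a₇ - a₈ - 1)) * ((a₂ + 1) * (a₄ + 1))
          * (a₂ + a₃ + a₆ - a₈ + s + t + 2) * (a₇ + t + 1) )
      * (a₄ - a₆ + a₈ + 1)
    = ((a₂ + 1) * (a₄ + 1))
      * ( (a₄ - a₆ + a₈ + 1) * (a₁ + a₂ - a₄ + a₆ - a₈ + t + 1) * (a₂ + a₃ + a₆ - a₈ + s + t + 2)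
            * (a₇ + t + 1) * (a₃ + a₆ - a₈ + t + 1)
        - (a₄ - a₆ + a₈ + 1) * t * (a₂ + a₃ - a₄ + 2 * a₆ - 2 * a₈ + s + t + 1)
            * (a₁ + a₇ + t + 2) * (a₂ + a₃ + a₆ - a₈ + t + 2) ) := by
  ring

end Summit.KontsevichZagierPeriods.Zeta5Search.WedgeDictionary
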